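import Mathlib.Analysis.SpecialFunctions.Pow.Real
import Literature.Computability.Complexity.PNPNaturalProofs
import Literature.Computability.Complexity.CircuitSizeProofs
import Literature.Computability.Complexity.GrowthBounds
import Literature.Computability.MetaComplexity.GGM
import HarnessLib

/-!
# P vs NP: the natural proofs barrier — proofs (Razborov–Rudich 1997, Thm. 4.1)

Sibling proof file of `PNPNaturalProofs.lean` (D-0014: facts are `def X : Prop`, discharges are
`theorem X_holds : X`). It discharges

* `natural_proofs_barrier_holds : natural_proofs_barrier` (**pnp.S18**; Razborov–Rudich 1997,
  Thm. 4.1): a `P/poly`-natural property useful against `P/poly` breaks every pseudo-random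
  generator family in `P/poly` — `H(Gₖ) < 2^{k^ε}` for infinitely many (in fact all large) `k`;
* `not_isNatural_of_hard_prg_holds : not_isNatural_of_hard_prg` (its contrapositive).

## Proof (Razborov–Rudich 1997, Thm. 4.1; Arora–Barak 2009, §23.3; Müller–Pich 2020, Thm. 3.27)

Let `P' ⊆ P` be `P/poly`-constructive (test circuits `T_N` of size `q(N)` deciding the language
of truth tables, `test_of_isConstructive`) and large (`2^{2ⁿ} ≤ 2^{c₁ n} |P'ₙ|` for `n ≥ n₁`),
let `P` be useful against `P/poly`, and let every output bit of `Gₖ` have `B₂`-circuits of size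
`p(k)` (`cktSize_of_isInPPoly`). Fix `ε > 0`, pick `D ∈ ℕ` with `1/D < ε` and put
`n = n(k) = ⌊k^{1/D}⌋` (`Nat.nthRoot D k`), so `k < (n+1)^D`. The finite core is
`Literature.Computability.MetaComplexity.prgHardness_le_of_test` (`Literature/Computability/MetaComplexity/GGM.lean`):
(1) the GGM functions `f_x(y) = bit₀(G_y(x))` on `n` variables have circuits of size
`n (2 k p(k) + 4 k) + 2 = poly(n)` (`circuitSizeOver_ggm_le`), so by usefulness (with the
exponent `c₂` of that polynomial) they lie outside `Pₙ ⊇ P'ₙ` for `n ≥ n₀` and `T_{2ⁿ}` rejects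
their truth tables; (2) `T_{2ⁿ}` accepts `|P'ₙ| ≥ 2^{-c₁ n} 2^{2ⁿ}` truth tables
(`card_test_eq`); (3) the hybrid argument yields a distinguisher for `Gₖ` of size
`≤ k + 2ⁿ⁺¹ k (p(k)+1) + q(2ⁿ) ≤ 2^{c₃ n}` (everything is `2^{O(n)}` as `k < (n+1)^D`;
`Literature.Computability.Complexity.IsExpBounded`) and advantage `≥ 2^{-c₁ n}/(2ⁿ - 1)`; with `c = c₃ + c₁ + 1` both
`size ≤ 2^{c n}` and `2^{-c n} ≤ advantage` hold, so `H(Gₖ) ≤ 2^{c n}`; (4) `2^{c n(k)} < 2^{k^ε}`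
for all large `k` since `c k^{1/D} < k^ε` (`eventually_two_pow_nthRoot_lt`). All thresholds
(`n ≥ n₀, n₁, n₂, 1`) hold for large `k` because `n(k) → ∞` (`tendsto_nthRoot`); `∀ᶠ` implies
the stated `∃ᶠ`.

## Contents (helpers)

* `cktSize_of_isInPPoly`, `test_of_isConstructive`, `card_test_eq`: unpacking `IsInPPoly`,
  `IsConstructive PPoly`, and counting the truth tables accepted by the test circuit.
* The growth bookkeeping (`Literature.Computability.AlgebraicComplexity.IsPBounded` from `AlgebraicComplexity/ValiantClasses.lean`,
  `IsExpBounded`, `Nat.nthRoot D k = ⌊k^{1/D}⌋₊`, `eventually_two_pow_nthRoot_lt`) lives in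
  `Literature/Computability/Complexity/GrowthBounds.lean`, the GGM tree and the hybrid argument in
  `Literature/Computability/MetaComplexity/GGM.lean`.

## References

* A. A. Razborov, S. Rudich, *Natural proofs*, J. Comput. System Sci. 55 (1997) 24–35, Thm. 4.1:
  "There is no lower bound proof which is `P/poly`-natural against `P/poly`, unless for every
  `ε > 0` no pseudo-random generator family in `P/poly` has hardness `2^{k^ε}`" (restated as
  Regan–Sivakumar–Cai 1995, Thm. 2, and Arora–Barak 2009, Thm. 23.1).
* S. Arora, B. Barak, *Computational Complexity: A Modern Approach*, CUP 2009, §23.3, proof of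
  Thm. 23.1 (pp. 591–592): "`n = m^{ε/2}` … the distinguisher … does so in `2^{O(n)}` time, which
  is less than `2^{m^ε}`".
* M. Müller, J. Pich, *Feasibly constructive proofs of succinct weak circuit lower bounds*,
  Ann. Pure Appl. Logic 171 (2020) 102735, §3.6, Thm. 3.27 and Claim 3.28 (p. 27).
-/

namespace Literature.Computability.Complexity

open MetaComplexity AlgebraicComplexity Finset Filter Polynomial

/-! ### Unpacking the hypotheses -/

/-- A generator family in `P/poly` has, for every output bit `s ↦ (Gₖ s)ᵢ`, a `B₂`-circuit of
size `≤ p(k)` in the `CktSize` calculus (the infimum `circuitSizeOver` is attained over `B₂`,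
`exists_circuit_size_eq_circuitSizeOver`).
[cite: RazborovRudich1997, §4 hypothesis "Gₖ in P/poly" of Thm. 4.1] -/
theorem cktSize_of_isInPPoly {G : PRGFamily} (hG : G.IsInPPoly) :
    ∃ p : Polynomial ℕ, ∀ (k : ℕ) (i : Fin (2 * k)),
      CktSize B2 (fun s (_ : Unit) => G k s i) (p.eval k) := by
  obtain ⟨p, hp⟩ := hG
  refine ⟨p, fun k i => ?_⟩
  obtain ⟨C₀, hC₀, -, hC₀e⟩ := (cktSize_univ fun (s : Fin k → Bool) (_ : Unit) => G k s i).toCircuit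
  obtain ⟨C, hC, hCf, hCs⟩ :=
    exists_circuit_size_eq_circuitSizeOver (B := B2) (f := fun s => G k s i) ⟨C₀, hC₀, hC₀e⟩
  exact ((C.cktSize_eval hC).congr (g := fun s (_ : Unit) => G k s i) fun s _ => hCf s).of_le
    (hCs ▸ hp k i)

/-- A `P/poly`-constructive property comes with a polynomial-size `B₂`-circuit family `T` such
that `T (2ⁿ)`, run on the truth table of `f : {0,1}ⁿ → {0,1}`, decides `f ∈ P'ₙ`
(Razborov–Rudich 1997, §2, "Constructivity"). [cite: RazborovRudich1997, §2 "Constructivity"] -/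
theorem test_of_isConstructive {P' : CombinatorialProperty} (h : IsConstructive PPoly P') :
    ∃ (q : Polynomial ℕ) (T : CircuitFamily), (∀ N, (T N).IsOver B2 ∧ (T N).size ≤ q.eval N) ∧
      ∀ (n : ℕ) (f : (Fin n → Bool) → Bool),
        ((T (2 ^ n)).eval fun t => f ((boolFunEquivFin n).symm t)) =
          (truthTableLanguage P').boolIndicator (truthTable f) := by
  simp only [IsConstructive, CombinatorialProperty.toLanguage_eq, PPoly, Set.mem_iUnion] at h
  obtain ⟨q, T, hT, hdec⟩ := h
  exact ⟨q, T, hT, fun n f => hdec.eval_eq _⟩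

open Classical in
/-- The test circuit `T (2ⁿ)` accepts exactly `|P'ₙ|` truth tables (Razborov–Rudich 1997, §2,
"Largeness": `|P'ₙ|` counts the accepted inputs of the test).
[cite: RazborovRudich1997, §2 "Largeness"] -/
theorem card_test_eq {P' : CombinatorialProperty} {T : CircuitFamily}
    (hT : ∀ (n : ℕ) (f : (Fin n → Bool) → Bool),
      ((T (2 ^ n)).eval fun t => f ((boolFunEquivFin n).symm t)) =
        (truthTableLanguage P').boolIndicator (truthTable f)) (n : ℕ) :
    #{h : (Fin n → Bool) → Bool |
        ((T (2 ^ n)).eval fun t => h ((boolFunEquivFin n).symm t)) = true} =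
      Nat.card (P' n) := by
  rw [Nat.card_eq_card_toFinset, ← Set.filter_mem_univ_eq_toFinset]
  congr 1
  ext h
  simp only [Finset.mem_filter, Finset.mem_univ, true_and, hT]
  exact (Set.mem_iff_boolIndicator _ _).symm.trans (truthTable_mem_truthTableLanguage_iff P' h)

/-! ### The theorem -/

/-- **Discharge of `natural_proofs_barrier`** (**pnp.S18**; Razborov–Rudich 1997, Thm. 4.1:
"There is no lower bound proof which is `P/poly`-natural against `P/poly`, unless for every
`ε > 0` no pseudo-random generator family in `P/poly` has hardness `2^{k^ε}`"). A
`P/poly`-natural property useful against `P/poly` breaks every generator family in `P/poly`: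
`H(Gₖ) < 2^{k^ε}` for all large `k`, hence for infinitely many `k` as stated. Proof as in the
source (see the module docstring): the property's test circuit tells the Goldreich–Goldwasser–
Micali functions `f_x(y) = bit₀(G_y(x))` on `n = ⌊k^{1/D}⌋` variables (`1/D < ε`) — which have
polynomial-size circuits and therefore fail the useful property — from random functions, which
pass it with probability `≥ 2^{-O(n)}` (largeness); the hybrid argument over the `2ⁿ - 1`
internal nodes of the GGM tree (`Literature.Computability.MetaComplexity.prgHardness_le_of_test`) turns the test into a
`2^{O(n)}`-size circuit with advantage `2^{-O(n)}` against `Gₖ`, and `2^{O(n)} < 2^{k^ε}`.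
[cite: RazborovRudich1997, Thm. 4.1] -/
theorem natural_proofs_barrier_holds : natural_proofs_barrier := by
  intro P hN hU G hG ε hε
  obtain ⟨P', hP'P, hcons, hlarge⟩ := hN
  obtain ⟨p, hp⟩ := cktSize_of_isInPPoly hG
  obtain ⟨q, T, hT, hTeval⟩ := test_of_isConstructive hcons
  obtain ⟨c₁, hc₁⟩ := hlarge
  obtain ⟨n₁, hn₁⟩ := eventually_atTop.1 hc₁
  -- the root parameter `D` with `1/D < ε`
  obtain ⟨D, hD⟩ := exists_nat_gt (1 / ε)
  have hDpos : 0 < D := by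
    have : (0 : ℝ) < D := lt_trans (by positivity) hD
    exact_mod_cast this
  have hDε : (D : ℝ)⁻¹ < ε := by
    rw [inv_lt_comm₀ (by exact_mod_cast hDpos) hε]
    simpa [one_div] using hD
  -- size bounds as functions of `n` alone (using `k < (n+1)^D`), in Bürgisser's `IsPBounded`
  have hpoly : ∀ r : Polynomial ℕ, IsPBounded fun n => r.eval n := fun r =>
    (isPBounded_iff_exists_polynomial_holds _).2 ⟨r, fun _ => le_rfl⟩
  obtain ⟨A, a, hA⟩ := (IsPBounded.iff_exists_le_mul_succ_pow _).1 (hpoly p)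
  have h1 : IsPBounded fun n => n + 1 := IsPBounded.add_holds IsPBounded.id (IsPBounded.const 1)
  have hK : IsPBounded fun n => (n + 1) ^ D := IsPBounded.pow_holds h1 D
  have hsbB : IsPBounded fun n => A * ((n + 1) ^ D + 1) ^ a :=
    IsPBounded.mul_holds (IsPBounded.const A)
      (IsPBounded.pow_holds (IsPBounded.add_holds hK (IsPBounded.const 1)) a)
  have hΦf : IsPBounded fun n =>
      n * (2 * ((n + 1) ^ D * (A * ((n + 1) ^ D + 1) ^ a)) + (n + 1) ^ D * 4) + 2 :=
    IsPBounded.add_holds (IsPBounded.mul_holds IsPBounded.id (IsPBounded.add_holds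
      (IsPBounded.mul_holds (IsPBounded.const 2) (IsPBounded.mul_holds hK hsbB))
      (IsPBounded.mul_holds hK (IsPBounded.const 4)))) (IsPBounded.const 2)
  obtain ⟨c₂, hc₂⟩ := hΦf.eventually_lt_pow
  obtain ⟨n₂, hn₂⟩ := eventually_atTop.1 hc₂
  have hΦd : IsExpBounded fun n =>
      (n + 1) ^ D + 2 ^ (n + 1) * (n + 1) ^ D * (A * ((n + 1) ^ D + 1) ^ a + 1) + q.eval (2 ^ n) :=
    ((IsExpBounded.of_isPBounded hK).add
      (((IsExpBounded.two_pow.mul (IsExpBounded.const 2)).mul (IsExpBounded.of_isPBounded hK)).mul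
        (IsExpBounded.of_isPBounded (IsPBounded.add_holds hsbB (IsPBounded.const 1))))).add
      (IsExpBounded.isPBounded_comp (hpoly q) IsExpBounded.two_pow)
  obtain ⟨c₃, hc₃⟩ := (hΦd.mono (f := fun n =>
      (n + 1) ^ D + 2 ^ (n + 1) * (n + 1) ^ D * (A * ((n + 1) ^ D + 1) ^ a + 1) + q.eval (2 ^ n))
      fun n => by rw [pow_succ]).le_two_pow
  obtain ⟨n₀, hn₀⟩ := eventually_atTop.1 (hU c₂)
  set c := c₃ + c₁ + 1 with hc
  -- everything happens for all large `k`
  have hev : ∀ᶠ k : ℕ in atTop, max (max n₀ n₁) (max n₂ 1) ≤ Nat.nthRoot D k ∧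
      ((2 ^ (c * Nat.nthRoot D k) : ℕ) : ℕ∞) < (⌈(2 : ℝ) ^ ((k : ℝ) ^ ε)⌉₊ : ℕ∞) :=
    ((tendsto_nthRoot hDpos.ne').eventually_ge_atTop _).and (eventually_two_pow_nthRoot_lt hDε c)
  refine (hev.mono fun k hk => ?_).frequently
  obtain ⟨hkn, hfin⟩ := hk
  refine lt_of_le_of_lt ?_ hfin
  -- the finite core, at this `k`
  simp only [max_le_iff] at hkn
  obtain ⟨⟨hkn₀, hkn₁⟩, hkn₂, hkn1⟩ := hkn
  have hk1 : 1 ≤ k := le_trans hkn1 (by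
    have := Nat.pow_nthRoot_le (Or.inl hDpos.ne') (n := D) (a := k)
    calc Nat.nthRoot D k ≤ Nat.nthRoot D k ^ D := Nat.le_self_pow hDpos.ne' _
      _ ≤ k := this)
  obtain ⟨k', rfl⟩ : ∃ k', k = k' + 1 := ⟨k - 1, by omega⟩
  obtain ⟨m, hm⟩ : ∃ m, Nat.nthRoot D (k' + 1) = m + 1 := ⟨Nat.nthRoot D (k' + 1) - 1, by omega⟩
  rw [hm] at hkn₀ hkn₁ hkn₂ ⊢
  have hkK : k' + 1 + 1 ≤ (m + 1 + 1) ^ D := by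
    have := Nat.lt_pow_nthRoot_add_one hDpos.ne' (k' + 1)
    rw [hm] at this
    omega
  set sb := p.eval (k' + 1) with hsb
  have hsb_le : sb ≤ A * ((m + 1 + 1) ^ D + 1) ^ a :=
    (hA (k' + 1)).trans (Nat.mul_le_mul_left _ (Nat.pow_le_pow_left (by omega) a))
  have hg : ∀ (b : Bool) (j : Fin (k' + 1)),
      CktSize B2 (fun s (_ : Unit) => halfGen (G (k' + 1)) b s j) sb :=
    fun b j => hp (k' + 1) (halfEquiv (k' + 1) (b, j))
  apply prgHardness_le_of_test (G (k' + 1)) (hp (k' + 1)) (T (2 ^ (m + 1))) (hT _).1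
    (B := ((2 : ℝ) ^ (c₁ * (m + 1)))⁻¹)
  · -- usefulness: the GGM functions have small circuits, so the test rejects them
    intro x
    rw [hTeval (m + 1) (fun y => ggmLab (halfGen (G (k' + 1))) x (m + 1) y 0)]
    refine (Set.notMem_iff_boolIndicator _ _).1 fun hmem' => ?_
    have hmem := (truthTable_mem_truthTableLanguage_iff P' _).1 hmem'
    have hlt : (m + 1) ^ c₂ <
        circuitSizeOver B2 (fun y => ggmLab (halfGen (G (k' + 1))) x (m + 1) y 0) :=
      hn₀ (m + 1) hkn₀ _ (hP'P _ hmem)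
    have hle := circuitSizeOver_ggm_le (halfGen (G (k' + 1))) hg x 0 (m + 1)
    have hΦ := hn₂ (m + 1) hkn₂
    have : (m + 1) * (2 * ((k' + 1) * sb) + (k' + 1) * 4) + 2 ≤
        (m + 1) * (2 * ((m + 1 + 1) ^ D * (A * ((m + 1 + 1) ^ D + 1) ^ a)) +
          (m + 1 + 1) ^ D * 4) + 2 := by
      gcongr <;> omega
    omega
  · -- largeness: the test accepts a `2^{-c₁ n}` fraction of all truth tables
    rw [card_test_eq hTeval]
    have h := hn₁ (m + 1) hkn₁
    have h' : (2 : ℝ) ^ 2 ^ (m + 1) ≤ 2 ^ (c₁ * (m + 1)) * Nat.card (P' (m + 1)) := by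
      exact_mod_cast h
    rw [inv_mul_le_iff₀ (by positivity)]
    exact h'
  · -- size of the distinguisher
    calc k' + 1 + 2 ^ (m + 1 + 1) * (k' + 1) * (sb + 1) + (T (2 ^ (m + 1))).size
        ≤ (m + 1 + 1) ^ D +
            2 ^ (m + 1 + 1) * (m + 1 + 1) ^ D * (A * ((m + 1 + 1) ^ D + 1) ^ a + 1) +
            q.eval (2 ^ (m + 1)) := by
          gcongr
          · omega
          · omega
          · exact (hT _).2
      _ ≤ 2 ^ (c₃ * (m + 1)) := hc₃ (m + 1) (by omega)
      _ ≤ 2 ^ (c * (m + 1)) := Nat.pow_le_pow_right (by norm_num) (by rw [hc]; nlinarith)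
  · -- advantage versus `1/S`
    have hN : ((2 ^ (m + 1) - 1 : ℕ) : ℝ) ≤ 2 ^ (m + 1) := by
      have : 2 ^ (m + 1) - 1 ≤ 2 ^ (m + 1) := Nat.sub_le _ _
      exact_mod_cast this
    have hNpos : (0 : ℝ) < ((2 ^ (m + 1) - 1 : ℕ) : ℝ) := by
      have : 0 < 2 ^ (m + 1) - 1 := by
        have : 2 ≤ 2 ^ (m + 1) := by
          calc (2:ℕ) = 2 ^ 1 := by norm_num
            _ ≤ 2 ^ (m + 1) := Nat.pow_le_pow_right (by norm_num) (by omega)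
        omega
      exact_mod_cast this
    rw [div_le_div_iff₀ (by positivity) hNpos, one_mul]
    calc ((2 : ℝ) ^ (c₁ * (m + 1)))⁻¹ * ((2 ^ (c * (m + 1)) : ℕ) : ℝ)
        = 2 ^ (c * (m + 1)) / 2 ^ (c₁ * (m + 1)) := by push_cast; ring
      _ = 2 ^ (c * (m + 1) - c₁ * (m + 1)) := by
          rw [pow_sub₀ _ (by norm_num) (by rw [hc]; nlinarith)]
          ring
      _ ≥ 2 ^ (m + 1) := by
          apply pow_le_pow_right₀ (by norm_num)
          rw [hc]
          have : (c₃ + c₁ + 1) * (m + 1) - c₁ * (m + 1) = (c₃ + 1) * (m + 1) := by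
            rw [show (c₃ + c₁ + 1) * (m + 1) = (c₃ + 1) * (m + 1) + c₁ * (m + 1) by ring]
            exact Nat.add_sub_cancel _ _
          rw [this]
          nlinarith
      _ ≥ ((2 ^ (m + 1) - 1 : ℕ) : ℝ) := hN

/-- **Discharge of `not_isNatural_of_hard_prg`** (**pnp.S18**, contrapositive form of
Razborov–Rudich 1997, Thm. 4.1, as usually quoted): if some generator family in `P/poly` has
hardness `≥ 2^{k^ε}` for all large `k`, then no combinatorial property is both `P/poly`-natural
and useful against `P/poly`. Immediate from `natural_proofs_barrier_holds`.
[cite: RazborovRudich1997, Thm. 4.1] -/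
theorem not_isNatural_of_hard_prg_holds : not_isNatural_of_hard_prg := by
  rintro ⟨G, hG, ε, hε, hk⟩ ⟨P, hN, hU⟩
  exact (natural_proofs_barrier_holds P hN hU G hG ε hε) (hk.mono fun k hk' => not_lt.mpr hk')

end Literature.Computability.Complexity
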